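import Summits.BirchSwinnertonDyer.BirchSwinnertonDyer.Theorems.ThetaPartnerAtTwoSignedControlAtTwoCasselsOfPT
import Summits.BirchSwinnertonDyer.BirchSwinnertonDyer.Theorems.ThetaPartnerAtTwoSignedControlAtTwoCasselsPTModKummerAt
import Summits.BirchSwinnertonDyer.BirchSwinnertonDyer.Theorems.KolyvaginRoadThreePTSelmerComplementAtOfMiddleExact
import HarnessLib

/-!
# Cassels' theorem AT ONE CURVE AND ONE PRIME from PER-LEVEL / PER-MODULE Poitou–Tate data (crux K4, line `eulerchar`,
# Cassels lane — the lead's steer: «prefer the per-level / per-module PT hypothesis shape»)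

Crux K4 `SignedControlAtTwo` (stmt-BirchSwinnertonDyer-20309), width seat `prover-bsd-wall-tp2-p3-w3` g6; sequel of
`…CasselsOfPT.lean` (`casselsSurjectivity_H1Sigma_of_poitouTate`, from the ALL-level ALL-module named fact). The K4 lead
(tp2-p3 g4, bsd-wall STATUS 05:01Z / 06:11Z) asked for the conclusion to be reachable from a 2-power / per-module delivery
of Poitou–Tate. This file provides it:

* `cassels_at_of_forall_selmerComplementAt W p` — the BODY of `Greenberg1999.casselsSurjectivity_H1Sigma K` at the curve `W`
  and the prime `p`, from: for every `k ≥ 1`, SOME family of local invariant maps at level `p^k` which is injective at the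
  finite places and satisfies Howard's Thm. 2.1.11 inclusion (i) AT THE MODULE `E[p^k]` (verbatim proof of the all-level file,
  through `exists_mem_kummerOutside_localization_sub_mem_of_selmerComplementAt`);
* `cassels_at_of_forall_middleExact_canonical W p` — the same from Milne I Thm. 4.10(b) `Ker γ¹ ⊆ Im β¹` for the modules
  `E[p^k]` (`k ≥ 1`) and THE canonical invariant maps `LocalInvariants.canonical K (p^k)` (tree
  `PTAt.selmerComplementAt_canonical_of_middleExact`, `LocalInvariants.canonical_isPerfect`): at `p = 2` over `ℚ` this is
  exactly what the Poitou–Tate lanes (lead's `MuReal*`, koly's dévissage, schneider-door's class formation) deliver module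
  by module;
* `casselsSurjectivity_H1Sigma_of_forall_middleExact_canonical` — the named statement for `K` from middle exactness for all
  `E[p^k]` (all curves, all primes).

THEOREMS ONLY (no definition, no named fact, no `sorry`); the finiteness instance `finite_geomTorsion_pow` is a local
instance so that the per-module hypotheses can be STATED under the binder `∀ k`. BSD is not proved by any of this.

References: [GreenbergLNM1716] §4 Appendix, Prop. 4.13, pp. 120–123; [MilneADT2006] I Thm. 4.10(b), Cor. 2.3, Thm. 2.6;
[Howard2004HeegnerKolyvagin] Thm. 2.1.11.
-/

set_option autoImplicit false
-- the Theorems namespace of this sub repeats the summit name by design (D-0017 nested layout)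
set_option linter.dupNamespace false

noncomputable section

open scoped Classical

open CategoryTheory Field NumberField IsDedekindDomain Function WeierstrassCurve
open Literature.NumberTheory.EllipticCurves Literature.NumberTheory.EllipticCurves.GreenbergSelmer
open Literature.NumberTheory.EllipticCurves.GreenbergVatsal2000
open Literature.NumberTheory.GaloisRepresentations
open Literature.NumberTheory.GaloisRepresentations.DiscreteGaloisModule (SelmerStructure unramifiedSubgroup mu MuCarrier
  localTatePairingZMod tateDual)
open Literature.NumberTheory.GaloisCohomology
open scoped ContRepresentation

namespace Summit.BirchSwinnertonDyer.BirchSwinnertonDyer.Theorems.SignedEC.CasselsPT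

open Summit.BirchSwinnertonDyer.Rank1Residual.X11b Summit.BirchSwinnertonDyer.Rank1Residual.X11b.KummerPT
open Summit.BirchSwinnertonDyer.Rank1Residual.X11b.LocBridge
open Summit.BirchSwinnertonDyer.Rank1Residual.X11b.Levels
open Summit.BirchSwinnertonDyer.Rank1Residual.X11b.AcSelmer
open Summit.BirchSwinnertonDyer.Rank1Residual.X11b.Relaxation

-- `E[p^k]` is finite: needed to STATE the per-module Poitou–Tate hypotheses under the binder `∀ k` (as in the X11b files).
attribute [local instance] finite_geomTorsion_pow Levels.neZero_pow

section Main

variable {K : Type} [Field K] [NumberField K]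

/-- **Cassels' theorem at one curve `W` and one prime `p`, from per-level Poitou–Tate data**: the body of
`Greenberg1999.casselsSurjectivity_H1Sigma K` at `(W, p)`, GIVEN for every `k ≥ 1` a family of local invariant maps at level
`p^k`, injective at the finite places, with Howard's Thm. 2.1.11 inclusion (i) at the module `E[p^k]`. Proof: verbatim
`casselsSurjectivity_H1Sigma_of_poitouTate` (module docstring of `…CasselsOfPT.lean`) with the per-module exactness
`exists_mem_kummerOutside_localization_sub_mem_of_selmerComplementAt`. [cite: GreenbergLNM1716, §4 Appendix, Prop. 4.13 and p. 122]
[cite: Howard2004HeegnerKolyvagin, Thm. 2.1.11 (arXiv:1202.6340 p. 6)] [cite: MilneADT2006, Ch. I, Thm. 4.10 and Lemma 6.15] -/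
theorem cassels_at_of_forall_selmerComplementAt (W : WeierstrassCurve K) [W.IsElliptic] (p : ℕ) [Fact p.Prime]
    (hPTk : ∀ k : ℕ, 0 < k → ∃ inv : LocalInvariants K (p ^ k),
      (∀ v : HeightOneSpectrum (𝓞 K), Injective (inv (Sum.inr v))) ∧
      ∀ (S : Finset (Place K)),
        (∀ v : HeightOneSpectrum (𝓞 K), (Sum.inr v : Place K) ∉ S →
          ((p ^ k : ℕ) : 𝓞 K) ∉ v.asIdeal ∧ GaloisRep.IsUnramifiedAt v (W.torsionGaloisModule ((p ^ k : ℕ) : ℤ))) →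
        ∀ (𝓕 𝓖 : SelmerStructure (W.torsionGaloisModule ((p ^ k : ℕ) : ℤ))), 𝓕 ≤ 𝓖 →
          𝓕.IsUnramifiedOutside S → 𝓖.IsUnramifiedOutside S →
          ∀ t : Π v : Place K, galoisCohomology ((W.torsionGaloisModule ((p ^ k : ℕ) : ℤ)).toLocal v) 1,
            (∀ v ∈ S, t v ∈ 𝓖 v) →
            (∀ y ∈ (inv.dualSelmerStructure (W.torsionGaloisModule ((p ^ k : ℕ) : ℤ)) 𝓕).selmerGroup,
              ∑ v ∈ S, localTatePairingZMod (W.torsionGaloisModule ((p ^ k : ℕ) : ℤ)) (p ^ k) v (inv v) (t v)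
                (galoisCohomology.localization ((W.torsionGaloisModule ((p ^ k : ℕ) : ℤ)).tateDual (p ^ k)) v 1 y) =
                  0) →
            ∃ x ∈ 𝓖.selmerGroup, ∀ v ∈ S,
              galoisCohomology.localization (W.torsionGaloisModule ((p ^ k : ℕ) : ℤ)) v 1 x - t v ∈ 𝓕 v) :
    Finite (W.selmerGroupPInfty p) →
    Nat.card (MulAction.fixedPoints (Field.absoluteGaloisGroup K) (W.geomPrimaryTorsion p)) = 1 →
    ∀ (S₀ : Set (HeightOneSpectrum (𝓞 K))), S₀.Finite →
      (∀ v : HeightOneSpectrum (𝓞 K), v ∉ S₀ → ((p : ℕ) : 𝓞 K) ∉ v.asIdeal → W.HasGoodReductionAt v) →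
    ∀ (x : ∀ v : HeightOneSpectrum (𝓞 K),
        discreteH1 (localSubgroup (⊤ : Subgroup (Field.absoluteGaloisGroup K)) (v.adicCompletion K))
          (localPoints W (v.adicCompletion K)))
      (xi : ∀ w : InfinitePlace K,
        discreteH1 (localSubgroup (⊤ : Subgroup (Field.absoluteGaloisGroup K)) w.Completion)
          (localPoints W w.Completion)),
      (∀ v, ∃ k : ℕ, p ^ k • x v = 0) → (∀ w, ∃ k : ℕ, p ^ k • xi w = 0) →
      ∃ y : W.subgroupH1 p (⊤ : Subgroup (Field.absoluteGaloisGroup K)),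
        y ∈ unramifiedOutside (⊤ : Subgroup (Field.absoluteGaloisGroup K)) (W.geomPrimaryTorsion p) p S₀ ∧
        (∀ v, (v ∈ S₀ ∨ ((p : ℕ) : 𝓞 K) ∈ v.asIdeal) →
          W.localResOver p ⊤ (v.adicCompletion K) y = x v) ∧
        (∀ w, W.localResOver p ⊤ w.Completion y = xi w) := by
  intro hSelFin hE0 S₀ hS₀fin hgood x xi hx hxi
  classical
  have hprime : p.Prime := Fact.out
  haveI : CompactSpace (absoluteGaloisGroup K) := absoluteGaloisGroup_compactSpace K
  -- (0) fixed points
  have hfix : ∀ a : W.geomPrimaryTorsion p, (∀ σ : absoluteGaloisGroup K, σ • a = a) → a = 0 :=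
    forall_fixed_eq_zero_of_natCard_fixedPoints_eq_one W p hE0
  -- (1) the finite set `Σ_f = S₀ ∪ {v ∣ p}`
  have hp0 : (Ideal.span {((p : ℕ) : 𝓞 K)} : Ideal (𝓞 K)) ≠ 0 := by
    rw [Ne, Ideal.zero_eq_bot, Ideal.span_singleton_eq_bot]
    exact_mod_cast hprime.ne_zero
  have hpfin : {v : HeightOneSpectrum (𝓞 K) | ((p : ℕ) : 𝓞 K) ∈ v.asIdeal}.Finite := by
    refine (Ideal.finite_factors hp0).subset fun v hv ↦ ?_
    exact (Ideal.dvd_span_singleton).mpr hv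
  set Sf : Finset (HeightOneSpectrum (𝓞 K)) := (hS₀fin.union hpfin).toFinset with hSfdef
  have hSf : ∀ v : HeightOneSpectrum (𝓞 K), v ∈ Sf ↔ v ∈ S₀ ∨ ((p : ℕ) : 𝓞 K) ∈ v.asIdeal := fun v ↦ by
    rw [hSfdef, Set.Finite.mem_toFinset, Set.mem_union, Set.mem_setOf_eq]
  -- the given classes in `H¹(Γ_{K_v}, E(K̄_v))` and a common exponent `p^n`
  choose kx hkx using hx
  choose ki hki using hxi
  choose a ha hpa using fun v : HeightOneSpectrum (𝓞 K) ↦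
    exists_preimage_localSubgroup_top W p (v.adicCompletion K) (kx v) (x v) (hkx v)
  choose ai hai hpai using fun w : InfinitePlace K ↦
    exists_preimage_localSubgroup_top W p w.Completion (ki w) (xi w) (hki w)
  set n : ℕ := Sf.sup kx + Finset.univ.sup ki with hndef
  have han : ∀ v ∈ Sf, p ^ n • a v = 0 := fun v hv ↦
    pow_nsmul_eq_zero_of_le p ((Finset.le_sup (f := kx) hv).trans (Nat.le_add_right _ _)) _ (hpa v)
  have hain : ∀ w : InfinitePlace K, p ^ n • ai w = 0 := fun w ↦
    pow_nsmul_eq_zero_of_le p ((Finset.le_sup (f := ki) (Finset.mem_univ w)).trans (Nat.le_add_left _ _)) _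
      (hpai w)
  -- (2) the exponent `p^e` of the relaxed Selmer group
  set A : AddSubgroup (W.galH1Primary p) :=
    ⨅ v : HeightOneSpectrum (𝓞 K), selmerLocalKerPrimary W (v.adicCompletion K) p with hAdef
  haveI : Finite A := finite_iInf_selmerLocalKerPrimary W p
  obtain ⟨e, he⟩ := exists_forall_pow_nsmul_eq_zero_of_finite W p A
  -- (3) the level `N = p ^ k`, `k = n + 1 + e`
  set k : ℕ := n + 1 + e with hkdef
  have hk : 0 < k := by omega
  haveI : NeZero (p ^ k) := ⟨pow_ne_zero k hprime.ne_zero⟩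
  have hNz : ((p ^ k : ℕ) : ℤ) ≠ 0 := by exact_mod_cast pow_ne_zero k hprime.ne_zero
  have hez : ((p ^ e : ℕ) : ℤ) ≠ 0 := by exact_mod_cast pow_ne_zero e hprime.ne_zero
  have hdz : ((p ^ (n + 1) : ℕ) : ℤ) ≠ 0 := by exact_mod_cast pow_ne_zero (n + 1) hprime.ne_zero
  have hlev : ((p ^ e : ℕ) : ℤ) * ((p ^ (n + 1) : ℕ) : ℤ) = ((p ^ k : ℕ) : ℤ) := by
    rw [hkdef]; push_cast; ring
  haveI : Finite (W.geomTorsion ((p ^ k : ℕ) : ℤ)) := finite_geomTorsion_of_neZero W _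
  -- the Poitou–Tate family and the Weil pairing at level `N`
  obtain ⟨inv, hinj, hcomplAt⟩ := hPTk k hk
  have hp2 : 2 ≤ p ^ k := le_trans hprime.two_le (Nat.le_self_pow hk.ne' p)
  have hchar : ((p ^ k : ℕ) : K) ≠ 0 := Nat.cast_ne_zero.mpr (pow_ne_zero _ hprime.ne_zero)
  obtain ⟨ew, hμ, hadd₁, hadd₂, halt, hnondeg, hgal⟩ := W.exists_weilPairing_holds (p ^ k) hp2 hchar
  -- (4) Kummer lifts of the local classes to level `N`
  let b : Π v : Place K, discreteH1 (absoluteGaloisGroup (Place.Completion v)) (localPoints W (Place.Completion v)) :=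
    fun v ↦ match v with
      | Sum.inl w => ai w
      | Sum.inr u => if u ∈ Sf then a u else 0
  have hbn : ∀ v : Place K, p ^ n • b v = 0 := by
    rintro (w | u)
    · exact hain w
    · by_cases hu : u ∈ Sf
      · simp only [b, if_pos hu]; exact han u hu
      · simp only [b, if_neg hu]; exact smul_zero _
  have hbN : ∀ v : Place K, ((p ^ k : ℕ) : ℤ) • (b v : galoisCohomology (W.localGaloisModule (Place.Completion v)) 1) = 0 :=
    fun v ↦ by
      rw [natCast_zsmul]
      exact pow_nsmul_eq_zero_of_le p (show n ≤ k by omega) _ (hbn v)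
  have hlift : ∀ v : Place K, ∃ t : galoisCohomology
      (GaloisRep.restrictField (Place.Completion v) (W.torsionGaloisModule ((p ^ k : ℕ) : ℤ))) 1,
      galoisCohomology.map (W.torsionPointsMapIntertwining ((p ^ k : ℕ) : ℤ) (Place.Completion v)) 1 t = b v := by
    intro v
    haveI : CharZero (Place.Completion v) :=
      charZero_of_injective_algebraMap (algebraMap K (Place.Completion v)).injective
    exact W.exists_map_torsionPointsMapIntertwining_eq_of_zsmul_eq_zero (Place.Completion v) hNz _ (hbN v)
  choose t ht using hlift
  -- `p^{n+1} • t_v ∈ 𝓛_v`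
  have htL : ∀ v : Place K, p ^ (n + 1) • t v ∈ W.kummerSelmerStructure ((p ^ k : ℕ) : ℤ) v := by
    intro v
    change galoisCohomology.map (W.torsionPointsMapIntertwining ((p ^ k : ℕ) : ℤ) (Place.Completion v)) 1
      (p ^ (n + 1) • t v) = 0
    rw [map_nsmul, ht v]
    exact pow_nsmul_eq_zero_of_le p (Nat.le_succ n) _ (hbn v)
  -- (5) the set `Σ = ∞ ∪ Σ_f` and Poitou–Tate modulo the Kummer conditions
  set S' : Finset (Place K) := (Finset.univ.image Sum.inl) ∪ (Sf.image Sum.inr) with hS'def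
  have hS'inr : ∀ u : HeightOneSpectrum (𝓞 K), (Sum.inr u : Place K) ∈ S' ↔ u ∈ Sf := fun u ↦ by
    simp only [hS'def, Finset.mem_union, Finset.mem_image, Finset.mem_univ, true_and, reduceCtorEq,
      exists_false, Sum.inr.injEq, exists_eq_right, false_or]
  obtain ⟨ξ, hξout, hξS'⟩ := exists_mem_kummerOutside_localization_sub_mem_of_selmerComplementAt W p k ew hμ hadd₁
    hadd₂ hgal halt hnondeg hk hinj hcomplAt S' t (fun c hcfin hcinf ↦ by
      -- (4') the obstruction vanishes term by term
      -- `p^e • c = 0`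
      have hcA : torsionPowToPrimaryH1 W p k c ∈ A :=
        torsionPowToPrimaryH1_mem_iInf_selmerLocalKerPrimary W p k c hcfin
      have hce' : torsionPowToPrimaryH1 W p k (p ^ e • c) = torsionPowToPrimaryH1 W p k 0 := by
        rw [map_zero]
        exact (map_nsmul (torsionPowToPrimaryH1 W p k) (p ^ e) c).trans (he _ hcA)
      have hce : p ^ e • c = 0 := torsionPowToPrimaryH1_injective W p k hfix hce'
      -- `c = ι_* z`, `z ∈ H¹(K, E[p^e])`
      obtain ⟨z, rfl⟩ := exists_map_torsionInclusion_eq_of_nsmul_eq_zero_of_eq W (pow_ne_zero e hprime.ne_zero)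
        hdz hlev (forall_fixed_geomTorsion_eq_zero W p e hfix) (Dvd.intro _ hlev) c hce
      refine Finset.sum_eq_zero fun v hv ↦ ?_
      -- the local term at `v` vanishes as soon as `loc_v c ∈ 𝓛_v`
      have key : galoisCohomology.localization (W.torsionGaloisModule ((p ^ k : ℕ) : ℤ)) v 1
            (galoisCohomology.map (W.torsionInclusion (Dvd.intro _ hlev)) 1 z) ∈
            W.kummerSelmerStructure ((p ^ k : ℕ) : ℤ) v →
          invWeilPairing W (p ^ k) ew hμ hadd₁ hadd₂ hgal inv v (t v)
            (galoisCohomology.localization (W.torsionGaloisModule ((p ^ k : ℕ) : ℤ)) v 1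
              (galoisCohomology.map (W.torsionInclusion (Dvd.intro _ hlev)) 1 z)) = 0 := by
        intro hmem
        haveI : CharZero (Place.Completion v) :=
          charZero_of_injective_algebraMap (algebraMap K (Place.Completion v)).injective
        rw [localization_map_one] at hmem ⊢
        obtain ⟨R, hR, hEq⟩ := exists_eq_nsmul_localKummerClass_of_map_torsionInclusion_mem W
          (E := Place.Completion v) (p ^ (n + 1)) hlev hez hNz hmem
        rw [hEq]
        exact invWeilPairing_nsmul_eq_zero_of_nsmul_mem W (p ^ k) ew hμ hadd₁ hadd₂ hgal halt inv v (p ^ (n + 1))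
          (htL v) (W.localKummerClass_mem_kummerLocalConditionAt _ hNz R hR)
      rcases v with w | u
      · -- an infinite place: `inv_w = 0` or `inv_w` injective
        rcases addMonoidHom_galoisCohomology_two_mu_inl_eq_zero_or_injective (p ^ k) w (inv (Sum.inl w)) with
          h0 | hinj
        · rw [invWeilPairing_apply, h0, AddMonoidHom.zero_apply]
        · exact key (hcinf w hinj)
      · exact key (hcfin u))
  -- (6) the class `y = res_⊤ ι_* ξ`
  refine ⟨resH1Hom (Literature.NumberTheory.EllipticCurves.subgroupIncl (⊤ : Subgroup (absoluteGaloisGroup K)))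
      (AddMonoidHom.id (W.geomPrimaryTorsion p)) (fun _ _ ↦ rfl) (torsionPowToPrimaryH1 W p k ξ), ?_, ?_, ?_⟩
  · -- unramified outside `S₀ ∪ {v ∣ p}`
    rw [GreenbergVatsal2000.mem_unramifiedOutside_iff]
    intro v hvS₀ hvp σ
    rw [show Literature.NumberTheory.EllipticCurves.conjH1 ⊤ (W.geomPrimaryTorsion p) σ = AddMonoidHom.id _ from
      W.conjH1_of_mem_holds p ⊤ (Subgroup.mem_top σ), AddMonoidHom.id_apply]
    apply res_torsionPowToPrimaryH1_mem_unramifiedKer W p k ξ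
    have hvSf : v ∉ Sf := fun h ↦ by
      rcases (hSf v).mp h with h | h
      · exact hvS₀ h
      · exact hvp h
    have hvS' : (Sum.inr v : Place K) ∉ S' := fun h ↦ hvSf ((hS'inr v).mp h)
    have hmem := (mem_kummerOutside_iff W (p ^ k) S' ξ).mp hξout (Sum.inr v) hvS'
    rw [← kummerSelmerStructure_inr_eq_unramifiedSubgroup W p k hvp (hgood v hvS₀ hvp)]
    exact hmem
  · -- the finite places of `Σ`
    intro v hv
    have hvSf : v ∈ Sf := (hSf v).mpr hv
    have hvS' : (Sum.inr v : Place K) ∈ S' := (hS'inr v).mpr hvSf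
    rw [localResOver_top_res_torsionPowToPrimaryH1 W p k (v.adicCompletion K) ξ, ← ha v]
    congr 1
    -- `κ_v(loc_v ξ) = κ_v(t_v) = a_v`
    have hsub := map_torsionPointsMapIntertwining_eq_of_sub_mem W (hξS' (Sum.inr v) hvS')
    rw [ht (Sum.inr v)] at hsub
    have hb : b (Sum.inr v) = a v := by simp only [b, if_pos hvSf]
    exact hsub.trans hb
  · -- the infinite places
    intro w
    have hwS' : (Sum.inl w : Place K) ∈ S' := by
      simp only [hS'def, Finset.mem_union, Finset.mem_image, Finset.mem_univ, true_and, exists_apply_eq_apply,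
        true_or]
    rw [localResOver_top_res_torsionPowToPrimaryH1 W p k w.Completion ξ, ← hai w]
    congr 1
    have hsub := map_torsionPointsMapIntertwining_eq_of_sub_mem W (hξS' (Sum.inl w) hwS')
    rw [ht (Sum.inl w)] at hsub
    exact hsub


/-- **Cassels' theorem at `(W, p)` from Milne I Thm. 4.10(b) for the modules `E[p^k]` and THE canonical invariant maps**
(`LocalInvariants.canonical K (p^k)`: the residue maps at the finite places, `[φ] ↦ φ(c,c) + φ(1,1)` at the real ones): the
per-module «basic middle exactness» `hE(E[p^k], S)` for every `k ≥ 1` and every admissible `S ⊇ ∞` is turned into Howard's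
inclusion (i) by the tree's `PTAt.selmerComplementAt_canonical_of_middleExact` (with `canonical_isPerfect`,
`canonical_injectiveAtRealPlaces`, Milne I 2.6), and fed to `cassels_at_of_forall_selmerComplementAt`. This is the shape in
which the Poitou–Tate lanes deliver duality at `p = 2` over `ℚ` module by module.
[cite: GreenbergLNM1716, §4 Appendix, Prop. 4.13 and p. 122] [cite: MilneADT2006, Ch. I, Thm. 4.10(b), Cor. 2.3, Thm. 2.6]
[cite: Howard2004HeegnerKolyvagin, Thm. 2.1.11 (arXiv:1202.6340 p. 6)] -/
theorem cassels_at_of_forall_middleExact_canonical (W : WeierstrassCurve K) [W.IsElliptic] (p : ℕ) [Fact p.Prime]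
    (hE : ∀ k : ℕ, 0 < k → ∀ S : Finset (Place K), (∀ w : InfinitePlace K, (Sum.inl w : Place K) ∈ S) →
      (∀ v : HeightOneSpectrum (𝓞 K), (Sum.inr v : Place K) ∉ S →
        ((p ^ k : ℕ) : 𝓞 K) ∉ v.asIdeal ∧ GaloisRep.IsUnramifiedAt v (W.torsionGaloisModule ((p ^ k : ℕ) : ℤ))) →
      ∀ t : Π v : Place K, galoisCohomology ((W.torsionGaloisModule ((p ^ k : ℕ) : ℤ)).toLocal v) 1,
        (∀ y : galoisCohomology ((W.torsionGaloisModule ((p ^ k : ℕ) : ℤ)).tateDual (p ^ k)) 1,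
          (∀ v : HeightOneSpectrum (𝓞 K), (Sum.inr v : Place K) ∉ S →
            galoisCohomology.localization ((W.torsionGaloisModule ((p ^ k : ℕ) : ℤ)).tateDual (p ^ k)) (Sum.inr v) 1 y ∈
              unramifiedSubgroup (GaloisRep.toLocal v ((W.torsionGaloisModule ((p ^ k : ℕ) : ℤ)).tateDual (p ^ k))) 1) →
          ∑ v ∈ S, localTatePairingZMod (W.torsionGaloisModule ((p ^ k : ℕ) : ℤ)) (p ^ k) v
            (LocalInvariants.canonical K (p ^ k) v) (t v)
            (galoisCohomology.localization ((W.torsionGaloisModule ((p ^ k : ℕ) : ℤ)).tateDual (p ^ k)) v 1 y) = 0) →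
        ∃ x : galoisCohomology (W.torsionGaloisModule ((p ^ k : ℕ) : ℤ)) 1,
          (∀ v : HeightOneSpectrum (𝓞 K), (Sum.inr v : Place K) ∉ S →
            galoisCohomology.localization (W.torsionGaloisModule ((p ^ k : ℕ) : ℤ)) (Sum.inr v) 1 x ∈
              unramifiedSubgroup (GaloisRep.toLocal v (W.torsionGaloisModule ((p ^ k : ℕ) : ℤ))) 1) ∧
          ∀ v ∈ S, galoisCohomology.localization (W.torsionGaloisModule ((p ^ k : ℕ) : ℤ)) v 1 x = t v) :
    Finite (W.selmerGroupPInfty p) →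
    Nat.card (MulAction.fixedPoints (Field.absoluteGaloisGroup K) (W.geomPrimaryTorsion p)) = 1 →
    ∀ (S₀ : Set (HeightOneSpectrum (𝓞 K))), S₀.Finite →
      (∀ v : HeightOneSpectrum (𝓞 K), v ∉ S₀ → ((p : ℕ) : 𝓞 K) ∉ v.asIdeal → W.HasGoodReductionAt v) →
    ∀ (x : ∀ v : HeightOneSpectrum (𝓞 K),
        discreteH1 (localSubgroup (⊤ : Subgroup (Field.absoluteGaloisGroup K)) (v.adicCompletion K))
          (localPoints W (v.adicCompletion K)))
      (xi : ∀ w : InfinitePlace K,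
        discreteH1 (localSubgroup (⊤ : Subgroup (Field.absoluteGaloisGroup K)) w.Completion)
          (localPoints W w.Completion)),
      (∀ v, ∃ k : ℕ, p ^ k • x v = 0) → (∀ w, ∃ k : ℕ, p ^ k • xi w = 0) →
      ∃ y : W.subgroupH1 p (⊤ : Subgroup (Field.absoluteGaloisGroup K)),
        y ∈ unramifiedOutside (⊤ : Subgroup (Field.absoluteGaloisGroup K)) (W.geomPrimaryTorsion p) p S₀ ∧
        (∀ v, (v ∈ S₀ ∨ ((p : ℕ) : 𝓞 K) ∈ v.asIdeal) →
          W.localResOver p ⊤ (v.adicCompletion K) y = x v) ∧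
        (∀ w, W.localResOver p ⊤ w.Completion y = xi w) := by
  refine cassels_at_of_forall_selmerComplementAt W p fun k hk ↦ ⟨LocalInvariants.canonical K (p ^ k),
    fun v ↦ (LocalInvariants.canonical_isPerfect v).1.1, fun S hS 𝓕 𝓖 hle h𝓕 h𝓖 ↦ ?_⟩
  have hprime : p.Prime := Fact.out
  have hpp : IsPrimePow (p ^ k) := ⟨p, k, hprime.prime, hk, rfl⟩
  have hM : ∀ m : W.geomTorsion ((p ^ k : ℕ) : ℤ), (p ^ k) • m = 0 := fun m ↦ AddSubgroup.torsionBy.nsmul m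
  exact (Summit.BirchSwinnertonDyer.Rank1Residual.X11b.Three.Koly.PTAt.selmerComplementAt_canonical_of_middleExact (p ^ k)
    hpp (W.torsionGaloisModule ((p ^ k : ℕ) : ℤ)) hM (hE k hk) S hS 𝓕 𝓖 hle h𝓕 h𝓖).1

/-- **`Greenberg1999.casselsSurjectivity_H1Sigma K` (every curve, every prime) from Milne I 4.10(b) for the modules
`E[p^k]` and THE canonical invariant maps** — the named statement, per-module hypotheses.
[cite: GreenbergLNM1716, §4 Appendix, Prop. 4.13 and p. 122] [cite: MilneADT2006, Ch. I, Thm. 4.10(b)] -/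
theorem casselsSurjectivity_H1Sigma_of_forall_middleExact_canonical
    (hE : ∀ (W : WeierstrassCurve K) [W.IsElliptic] (p : ℕ) [Fact p.Prime] (k : ℕ), 0 < k →
      ∀ S : Finset (Place K), (∀ w : InfinitePlace K, (Sum.inl w : Place K) ∈ S) →
      (∀ v : HeightOneSpectrum (𝓞 K), (Sum.inr v : Place K) ∉ S →
        ((p ^ k : ℕ) : 𝓞 K) ∉ v.asIdeal ∧ GaloisRep.IsUnramifiedAt v (W.torsionGaloisModule ((p ^ k : ℕ) : ℤ))) →
      ∀ t : Π v : Place K, galoisCohomology ((W.torsionGaloisModule ((p ^ k : ℕ) : ℤ)).toLocal v) 1,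
        (∀ y : galoisCohomology ((W.torsionGaloisModule ((p ^ k : ℕ) : ℤ)).tateDual (p ^ k)) 1,
          (∀ v : HeightOneSpectrum (𝓞 K), (Sum.inr v : Place K) ∉ S →
            galoisCohomology.localization ((W.torsionGaloisModule ((p ^ k : ℕ) : ℤ)).tateDual (p ^ k)) (Sum.inr v) 1 y ∈
              unramifiedSubgroup (GaloisRep.toLocal v ((W.torsionGaloisModule ((p ^ k : ℕ) : ℤ)).tateDual (p ^ k))) 1) →
          ∑ v ∈ S, localTatePairingZMod (W.torsionGaloisModule ((p ^ k : ℕ) : ℤ)) (p ^ k) v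
            (LocalInvariants.canonical K (p ^ k) v) (t v)
            (galoisCohomology.localization ((W.torsionGaloisModule ((p ^ k : ℕ) : ℤ)).tateDual (p ^ k)) v 1 y) = 0) →
        ∃ x : galoisCohomology (W.torsionGaloisModule ((p ^ k : ℕ) : ℤ)) 1,
          (∀ v : HeightOneSpectrum (𝓞 K), (Sum.inr v : Place K) ∉ S →
            galoisCohomology.localization (W.torsionGaloisModule ((p ^ k : ℕ) : ℤ)) (Sum.inr v) 1 x ∈
              unramifiedSubgroup (GaloisRep.toLocal v (W.torsionGaloisModule ((p ^ k : ℕ) : ℤ))) 1) ∧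
          ∀ v ∈ S, galoisCohomology.localization (W.torsionGaloisModule ((p ^ k : ℕ) : ℤ)) v 1 x = t v) :
    Greenberg1999.casselsSurjectivity_H1Sigma K :=
  fun W _ p _ ↦ cassels_at_of_forall_middleExact_canonical W p (hE W p)

end Main

end Summit.BirchSwinnertonDyer.BirchSwinnertonDyer.Theorems.SignedEC.CasselsPT

end
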